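/-
Copyright (c) 2026. All rights reserved.
Released under Apache 2.0 license as described in the file LICENSE.
Authors: abc-iut cell, prover seat abc-iut-L4-t5 (gen 9), over the statements of abc-iut-L4-t3 and the `⊞`-side move system
of abc-iut-f-101 (`LogFrobeniusObservablesMoves.lean`), of which this file is the `TS`-side analogue.
-/
import Literature.AnabelianGeometry.AbsoluteAnabelian.LogFrobeniusObservablesTSGraph
import Literature.AnabelianGeometry.AbsoluteAnabelian.Ltimes.LogFrobeniusObservables
import HarnessLib
import Literature.AnabelianGeometry.AbsoluteAnabelian.LogFrobeniusObservablesTSMoves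

/-!
# [AbsTopIII] Corollary 5.5 (iii), `TS`-half: the MOVE SYSTEM of the observable `S_log` on `(D•_{≤2} ∪ {𝒩⊞_v}) ∪ {𝒩_v}` — generators over ALL of `Γ⃗^log_v`, homotopies, termination, unique decomposition

S. Mochizuki, *Topics in absolute anabelian geometry III: global reconstruction algorithms*,
J. Math. Sci. Univ. Tokyo 22 (2015) 939–1156 [MochizukiAbsTopIII2015]; locators `p.N` = pages of the author's
manuscript (`paper:url-5493eb38cbb7`): Def 5.4 (iii) p. 126, (v) p. 127, (vii) p. 128 ("respectively,
`ι_{v,ε} : λ_{v,ν₁} ∘ Λ_{ν₁} → λ_{v,ν₂}`" for EVERY edge `ε` of `Γ⃗^log_v`, `λ_{v,ν}` = `λ⊞_{v,ν}` composed with `𝒩⊞_v → 𝒩_v`),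
Cor 5.5 (iii) p. 131 ("respectively, [the `ι_{v,ε}`] belong to a family of homotopies on `D•_{≤4}` that determines on the
portion of `D•_{≤4}` indexed by `v` a structure of observable `S_log` on the portion of `D•_{≤3}` indexed by `v`"), proof
p. 132 ("immediate from the definitions"), §0 p. 26 / Def 3.5 (ii)–(iii) pp. 75–76 (saturation; families of homotopies).

The `TS`-side companion of abc-iut-f-101's `LogFrobeniusObservablesMoves.lean` (the `⊞`-half `S_log⊞` on
`D•_{≤2} ∪ {𝒩⊞_v}`): preparation for the CONSTRUCTION of the observable `S_log` of Cor 5.5 (iii) as typed by abc-iut-L4-t3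
(`LogFrobeniusSetting.IsLogObservableTS`, `Cor55ObservablesTS` = FACT-LIST F-3080) from the `TS` ι-diamond law (converse of
abc-iut-w5-d097's `TSHomotopies.iota_diamond_of_isLogObservableTS`), on abc-iut-L4-t3's shape `logShapeTS v` = the portion
`D•_{≤2} ∪ {𝒩⊞_v}` with observation vertex `𝒩_v` (one more arrow, `𝒩⊞_v → 𝒩_v`, than the `⊞`-shape; at an ARCHIMEDEAN place
the observable was obtained by abc-iut-w5-d053 by push-forward along that arrow, `LogFrobeniusObservablesTSOfPlus.lean`;
the present generic route covers the NONARCHIMEDEAN places, where `Γ⃗^log_v ⊋ Γ⃗^⋉_v`):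

* `LogFrobeniusSetting.LogGenTS` — the generator pairs, indexed by `LogEdgeTS` = ALL edges of `Γ⃗^log_v` (at a
  nonarchimedean place one more than on the `⊞`-side: the `TS`-only arrow `k̄^× ↪ k̄`): (`pre`)
  `([𝒩⊞→𝒩]∘[λ⊞_{ν₁}], [𝒩⊞→𝒩]∘[λ⊞_{ν₂}])` = (`lamPathTS ν₁`, `lamPathTS ν₂`), (`post`)
  (`postLogDomPathTS`, `postLogCodPathTS`); `logGenHomTS T` — their prescribed homotopies, the `TS`-valued `ι_{v,ε}` of a
  `TS`-datum `T : L.TSHomotopies` re-typed along `pathFunctor_lamPathTS` & co.;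
* TERMINATION: weights `edgeWtTS` / `pathWtTS` from `LogVertex.rankTS` (`log ↦ 3`), strictly lowered by every move
  (`pathWtTS_lt_of_move`, `pathWtTS_le_of_chain`, `pathWtTS_lt_of_cons`);
* UNIQUE DECOMPOSITION of the paths of the `TS`-shape ending at `𝒩_v` (`eq_of_comp_lamPathTS_eq`,
  `eq_of_comp_lamPathTS_eq_comp_postLogDomPathTS`, `eq_of_comp_postLogDomPathTS_eq`: one more trailing arrow than on the
  `⊞`-side): the first move of a chain out of a path is determined by the path up to the forks of
  `LogFrobeniusObservablesTSGraph.lean`.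

Nothing is asserted about print here (definitions and bookkeeping over the typed interface); the coherence theorem and
the construction of `S_log` are in `LogFrobeniusObservablesTSOfIotaSquare.lean`.  Refereed pre-IUT material; nothing
here bears on [IUTchIII] Cor. 3.12; no side taken; typed ≠ proved elsewhere.

**`⋉`-TWIN (cell row «LTIMES-SUCCESSOR», L4-lead m162; typing finding T3g9-F1).**  This file is the verbatim
re-elaboration of `LogFrobeniusObservablesTSMoves.lean` over the successor interface `LogFrobeniusSettingLtimes`
(`Ltimes/LogFrobeniusCompatibility.lean`: `ι⊞_{v,ε}` indexed by the edges of `Γ⃗^⋉_v` at EVERY place, [AbsTopIII] Cor 5.5 (iii)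
p. 131), produced by the cell recipe `LTIMES-RECIPE.md`: names carry over inside `namespace LogFrobeniusSettingLtimes`, the
section variable is `Lt`, setting-independent declarations are NOT repeated (the originals are in scope), statements and
proofs are otherwise unchanged.  The original file over the frozen interface stays as it is.
SLICE T9-E (abc-iut-f-101 gen 6): the `TS`-shape `logShapeTS`, its paths `lamPathTS`/… and edges `LogEdgeTS` are the FROZEN
ones (exported by `Ltimes/LogFrobeniusObservables`), so the whole setting-free part of this file (weights, `LogGenTS`, termination,
unique decomposition) is exported; only the path-functor identifications and `logGenHomTS` (over `Lt.logDiagramTS`, the datum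
`T : Lt.TSHomotopies`) are re-elaborated — with `erw` at the seam where `Lt.logDiagramTS` (built over this namespace's copy of
`obsShape`) meets the exported paths, and the constructor patterns written `LogFrobeniusSetting.LogGenTS.pre/post`.
-/

set_option autoImplicit false

universe u

open CategoryTheory Quiver

namespace Literature.AnabelianGeometry.AbsoluteAnabelian

/-! ## The move system of `(D•_{≤2} ∪ {𝒩⊞_v}) ∪ {𝒩_v}`: weights, generators, homotopies -/

namespace LogFrobeniusSettingLtimes

export LogFrobeniusSetting (edgeWtTS pathWtTS pathWtTS_comp pathWtTS_lamPathTS pathWtTS_postLogDomPathTS pathWtTS_postLogCodPathTS pathWtTS_cons_log_toCore LogGenTS pathWtTS_lt_of_move pathWtTS_le_of_chain pathWtTS_lt_of_cons eq_of_comp_lamPathTS_eq eq_of_comp_lamPathTS_eq_comp_postLogDomPathTS eq_of_comp_postLogDomPathTS_eq)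

variable {Vmod : Type u} {isArc : Vmod → Bool} (Lt : LogFrobeniusSettingLtimes Vmod isArc) (v : Vmod)

/-- The path functor of `[𝒩⊞_v → 𝒩_v] ∘ [λ⊞_ν]` is `(Λ_ν ⋙ λ⊞_ν) ⋙ (𝒩⊞_v → 𝒩_v)` (`Λ_ν = 𝟭` at a pre-log vertex) — the
domain of `ι_{v,ε}`. [cite: MochizukiAbsTopIII2015, Def 5.4 (vii) p. 128] -/
theorem pathFunctor_lamPathTS (ν : LogVertex (isArc v)) (hν : ν.isPostLog = false) :
    (Lt.logDiagramTS v).pathFunctor (lamPathTS v ν hν) =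
      (frobeniusTwist Lt.log ν.isPostLog ⋙ Lt.lam v ν) ⋙ Lt.forget v := by
  -- `erw`: `logDiagramTS` (successor) is built over the `⋉`-namespace copy of `obsShape`, the generator paths over the
  -- exported frozen `logShapeTS` — equal up to unfolding only
  rw [lamPathTS]
  erw [DiagramOfCategories.pathFunctor_cons, DiagramOfCategories.pathFunctor_cons,
    DiagramOfCategories.pathFunctor_nil]
  rw [hν]
  rfl

/-- … and is `λ⊞_ν ⋙ (𝒩⊞_v → 𝒩_v) = λ_{v,ν}` itself — the codomain of `ι_{v,ε}`. [cite: MochizukiAbsTopIII2015, Def 5.4 (vii) p. 128] -/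
theorem pathFunctor_lamPathTS' (ν : LogVertex (isArc v)) (hν : ν.isPostLog = false) :
    Lt.lam v ν ⋙ Lt.forget v = (Lt.logDiagramTS v).pathFunctor (lamPathTS v ν hν) := by
  rw [lamPathTS]
  erw [DiagramOfCategories.pathFunctor_cons, DiagramOfCategories.pathFunctor_cons,
    DiagramOfCategories.pathFunctor_nil]
  rfl

/-- The path functor of `[𝒩⊞→𝒩]∘[λ⊞_{sl}]∘[id_⋎]∘[log]` is `(Λ_{ν₁} ⋙ λ⊞_{ν₁}) ⋙ (𝒩⊞_v → 𝒩_v)` for the post-log vertex `ν₁`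
(`Λ = log`, and `λ⊞_{sl} = λ⊞_{post-log}` by the proviso of Cor 5.5). [cite: MochizukiAbsTopIII2015, Def 5.4 (vii) p. 128] -/
theorem pathFunctor_postLogDomPathTS (ν₁ : LogVertex (isArc v)) (h₁ : ν₁.isPostLog = true) (n : ℤ)
    (hsl : (LogVertex.spaceLink (isArc v)).isPostLog = false) :
    (Lt.logDiagramTS v).pathFunctor (postLogDomPathTS v n hsl) =
      (frobeniusTwist Lt.log ν₁.isPostLog ⋙ Lt.lam v ν₁) ⋙ Lt.forget v := by
  rw [postLogDomPathTS]
  erw [DiagramOfCategories.pathFunctor_cons, DiagramOfCategories.pathFunctor_cons,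
    DiagramOfCategories.pathFunctor_cons, DiagramOfCategories.pathFunctor_cons,
    DiagramOfCategories.pathFunctor_nil]
  rw [h₁, LogVertex.eq_postLog_of_isPostLog _ h₁, ← Lt.lam_spaceLink_eq_postLog v]
  rfl

/-- The path functor of `[𝒩⊞→𝒩]∘[λ⊞_{ν₂}]∘[id_{⋎+1}]` is `λ⊞_{ν₂} ⋙ (𝒩⊞_v → 𝒩_v) = λ_{v,ν₂}`. [cite: MochizukiAbsTopIII2015, Def 5.4 (vii) p. 128] -/
theorem pathFunctor_postLogCodPathTS (n : ℤ) (ν₂ : LogVertex (isArc v)) (h₂ : ν₂.isPostLog = false) :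
    Lt.lam v ν₂ ⋙ Lt.forget v = (Lt.logDiagramTS v).pathFunctor (postLogCodPathTS v n ν₂ h₂) := by
  rw [postLogCodPathTS]
  erw [DiagramOfCategories.pathFunctor_cons, DiagramOfCategories.pathFunctor_cons,
    DiagramOfCategories.pathFunctor_cons, DiagramOfCategories.pathFunctor_nil]
  rfl

variable (T : Lt.TSHomotopies)

/-- **The prescribed homotopies of the generators**: the `TS`-valued `ι_{v,ε}` of the `TS`-datum `T`, re-typed along the
identifications of the path functors. [cite: MochizukiAbsTopIII2015, Cor 5.5 (iii) p. 131] -/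
noncomputable def logGenHomTS : ∀ ⦃c b : (logShapeTS (isArc := isArc) v).Vertex⦄ ⦃g g' : Path c b⦄,
    LogGenTS v g g' → ((Lt.logDiagramTS v).pathFunctor g ⟶ (Lt.logDiagramTS v).pathFunctor g')
  | _, _, _, _, LogFrobeniusSetting.LogGenTS.pre ν₁ ν₂ ε h₁ h₂ =>
    eqToHom (Lt.pathFunctor_lamPathTS v ν₁ h₁) ≫ T.iota v ε ≫ eqToHom (Lt.pathFunctor_lamPathTS' v ν₂ h₂)
  | _, _, _, _, LogFrobeniusSetting.LogGenTS.post ν₁ ν₂ ε h₁ h₂ hsl n =>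
    eqToHom (Lt.pathFunctor_postLogDomPathTS v ν₁ h₁ n hsl) ≫ T.iota v ε ≫
      eqToHom (Lt.pathFunctor_postLogCodPathTS v n ν₂ h₂)

/-! ## Termination: every move lowers the weight -/

end LogFrobeniusSettingLtimes

end Literature.AnabelianGeometry.AbsoluteAnabelian
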